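import Summits.HodgeConjecture.HodgeConjecture.Theorems.F0P6aSpecOrgansTwoQuotLegs
import HarnessLib

/-!
# `F0P6aSpecOrgansHrkG` — ★ RE-HOME of `Lines/F0_P6a_SpecOrgans.lean` (tree sha16 f8c3b4bc8f4404ac, 1249 l.), PART 4 of 5 — tree lines :902–:1200
See PART 1 `Theorems/F0P6aSpecOrgansBlockC.lean` for the full ★ re-home header and the original module docstring (verbatim there).  Same namespace (every
fully-qualified name unchanged); the scopes open at the cut are re-opened below with their `variable` ∕ `open` ∕ `set_option` ∕ `universe` lines replayed verbatim
from the tree, in order; the code after the replay block is the tree bytes :902–:1200, untouched except the (d1) cure named in PART 1.  HC_CM is proved only modulo the 7 printed citations (2 remaining: hLiu418 = stmt-HodgeConjecture-24832, h413 = stmt-HodgeConjecture-24833) until rung 0 closes; a re-home is count-neutral.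
-/

-- ── replay of the scopes open at tree line :902 (verbatim) ──
set_option autoImplicit false
set_option linter.dupNamespace false
noncomputable section
universe u
namespace Summit.HodgeConjecture.HodgeConjecture.Cruxes.HLiu418.F0P6aLineSpecialisation
section Block_G
open CategoryTheory CategoryTheory.Limits AlgebraicGeometry MonoidalCategory CartesianMonoidalCategory
set_option backward.isDefEq.respectTransparency false
open scoped MonObj
open Literature.AlgebraicGeometry.Motives Literature.AlgebraicGeometry.GroupSchemes Literature.AlgebraicGeometry.GroupSchemes.GroupSchemeKernel
open Literature.AlgebraicGeometry.GroupSchemes.AffineGroupScheme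
section HrkG
open NumberField IsDedekindDomain MulAction
open scoped Matrix Pointwise
open Literature.NumberTheory.Automorphic Literature.NumberTheory.Automorphic.UnitaryGroup
open Literature.AlgebraicGeometry.ShimuraVarieties.UnitaryCanonicalModel
open Literature.NumberTheory.Automorphic.Liu2021.AppendixC
open Literature.AlgebraicGeometry.Motives (AlgPoints IntegralModel SchemeOver thickening thickeningGalAction thickeningLift specOver)
open Literature.NumberTheory.DiophantineGeometry (geomResidueField specialFibreFunctor specResidueField)
open Literature.AlgebraicGeometry.RelativeSpec (ActionOver)
open Literature.AlgebraicGeometry.AbelianSchemes Literature.AlgebraicGeometry.AbelianSchemes.AbelianSchemeOver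
open Literature.AlgebraicGeometry.HodgeTheory Literature.AlgebraicGeometry.HodgeTheory.RingAction
open Literature.RingTheory.DedekindDomain
open Summit.HodgeConjecture.HodgeConjecture.Cruxes.HLiu418.F0P6aModuliDatumDefs
open Summit.HodgeConjecture.HodgeConjecture.Cruxes.HLiu418.F0P6aRGDAssembly
open Summit.HodgeConjecture.HodgeConjecture.Cruxes.HLiu418.F0P6aDatumOfInputs
variable {F : Type} [Field F] [NumberField F] [IsCMField F] {ι₁ : F →+* ℂ}
    {Jstar : Matrix (Fin 2) (Fin 2) F}
    {K₀ : C5.OpenCompactSubgroup ↥(finAdelic ↥(maximalRealSubfield F) F (IsCMField.complexConj F) 2 Jstar)}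
    {S : RecordSystemGS F Jstar ι₁ K₀} {hU7ₛ : S.HeckeTranslateDefinedOver}
    {hJ : (Jstar.map (IsCMField.complexConj F))ᵀ = Jstar} {hJu : IsUnit Jstar}
    {Fi : Type} [Field Fi] [Algebra F Fi] {Kc : C5.SmallLevel K₀} {G : Type} [Group G]
    {𝓜 : IntegralModel (𝓞 F) F ((thickening F Fi).obj (S.M.obj Kc))}
    {w : HeightOneSpectrum (𝓞 F)} {hw : (IsCMField.complexConj F) • w ≠ w} {h𝓨 : (𝓜.localise w).IsSmoothProper 1}
    {θ : ActionOver (𝓜.localise w).total.hom ((Fi ≃ₐ[F] Fi) × G)}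
    {e : Fi →ₐ[F] AlgebraicClosure (w.adicCompletion F)}

set_option maxHeartbeats 400000 in
set_option synthInstance.maxHeartbeats 100000 in
/-- **(RKG) `hrkG_of_dock` — THE RANK OF THE `𝔭_w𝔭_{c•w}`-LAYER OF THE SPECIAL FIBRE `A_x̄`, BY VALUE FOR EVERY CLOSED REALISATION** (the `hrkG` binder of the (C6′) fold
`comp_eq_one_iff_of_two_quotLegs`, LA2-p04 (g2) 11a42e41 :152–:157, TOKEN FOR TOKEN after `∀ xbar`).  For `I : RGDInputsAt …`, the dock `𝔡`, any special point `x̄` and ANY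
closed subgroup `j′ : G′ ↪ (sch₀Of 𝓜 w I.univ x̄).X` (affine, `Γ` finite, monomorphic homomorphism, closed immersion) whose `T`-points are exactly the points killed by
`act₀Of … a x̄`, `a ∈ 𝔭_w·𝔭_{c•w}`: `dim_{κ̄(w)} Γ(G′) = (q·q)·(q·q)`, `q = p^f`.  PROOF: the `w`-layer `Gw ↪ A_x̄` with `rk = q·q` by ★ p849994
`RingAction.exists_idealTorsionLayer_finrank_eq` at `w′ := 𝔭_w` (block data by ★ (O-CRT) `exists_eq_pow_mul_coprime` ∕ `exists_blockIdempotentFamily` at `p ∈ 𝔭_w` = `I.hpChar.2`,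
height socket (S-H) by ★ p846766 `hrank_specialFibre_of_isSmoothProper` with `#(𝒪_F ⧸ 𝔭_w) = p^f` from `I.hfDeg` + ★ `HeightOneSpectrum.card_quotient_smul`, `hg := I.hg ▸ I.relDim`,
commutativity `I.comm` — EXACTLY as spine §4 `blockDock_of_inputs` discharges them at `c•w`); the `c•w`-layer := the dock `(𝔡 x̄).G₀` (`hkerG₀`, `hι₀G`, `hrkG₀ : rk = q·q`);
`𝔭_w ⊔ 𝔭_{c•w} = ⊤` (`hw`, distinct maximal ideals); ★ p850494 `finrank_alg_eq_mul_of_idealTorsion_realisations_ringAction` at `ρ := (I.act.baseChange ι_s).baseChange x̄.left`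
(`ρ.i a = (act₀Of …).hom.hom.hom`, `rfl`). [cite: Tate1997FiniteFlatGroupSchemes, §(3.7) (p. 146)] [cite: Tate1967, §2.2]
[cite: RapoportSmithlingZhang2020Diagonal, §4.1 (p. 17)] [cite: Liu2021, Prop. D.8 p. 135, p. 137] -/
theorem hrkG_of_dock (I : RGDInputsAt F ι₁ Jstar K₀ S hU7ₛ hJ hJu Fi Kc G 𝓜 w hw h𝓨 θ e) [ExpChar (geomResidueField w) I.pChar]
    (𝔡 : ∀ xbar, DockAt I xbar) (xbar : AlgPoints (𝓜.localise w).reductionAt (geomResidueField w))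
    (G' : SchemeOver (geomResidueField w)) [GrpObj G'] [IsAffine G'.left] [Module.Finite (geomResidueField w) (Alg G')]
    (j' : G' ⟶ (sch₀Of 𝓜 w I.univ xbar).X) [IsMonHom j'] [IsClosedImmersion j'.left]
    (hG' : ∀ ⦃T : SchemeOver (geomResidueField w)⦄ (t : T ⟶ (sch₀Of 𝓜 w I.univ xbar).X),
      (∃ s : T ⟶ G', s ≫ j' = t) ↔ ∀ a ∈ w.asIdeal * ((IsCMField.complexConj F) • w).asIdeal, t ≫ (act₀Of 𝓜 w I.univ I.act a xbar).hom.hom.hom = 1) :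
    Module.finrank (geomResidueField w) (Alg G') = (I.pChar ^ I.fDeg * I.pChar ^ I.fDeg) * (I.pChar ^ I.fDeg * I.pChar ^ I.fDeg) := by
  classical
  -- instances of the place and of the characteristic (spine §4 `blockDock_of_inputs` verbatim)
  haveI : Fact I.pChar.Prime := ⟨I.hpChar.1⟩
  haveI : CharP (geomResidueField w) I.pChar := I.charP₀
  haveI : (w.asIdeal).IsMaximal := w.isMaximal
  haveI : (((IsCMField.complexConj F) • w).asIdeal).IsMaximal := ((IsCMField.complexConj F) • w).isMaximal
  haveI : IsCommMonObj I.univ.X := I.comm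
  haveI : IsLocallyNoetherian (Literature.AlgebraicGeometry.Motives.specOver w.asIdeal.ResidueField (geomResidueField w)).left :=
    inferInstanceAs (IsLocallyNoetherian (Spec (CommRingCat.of (geomResidueField w))))
  haveI : IsCommMonObj (((I.univ.baseChange (pullback.fst (𝓜.localise w).total.hom (specResidueField w))).baseChange
      (xbar.left : Spec (.of (geomResidueField w)) ⟶ pullback (𝓜.localise w).total.hom (specResidueField w))).X) :=
    AbelianSchemeOver.isCommMonObj_of_isLocallyNoetherian_base _
  haveI : Mono j' := Over.mono_of_mono_left j'
  -- the action at `x̄` in the assembly՚s currency; the reader `act₀Of` is its `i` ON THE NOSE (D-LINE :185, P6d probe 3a05f216)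
  have hact : ∀ a : 𝓞 F,
      ((I.act.baseChange (pullback.fst (𝓜.localise w).total.hom (specResidueField w))).baseChange
        (xbar.left : Spec (.of (geomResidueField w)) ⟶ pullback (𝓜.localise w).total.hom (specResidueField w))).i a =
        (act₀Of 𝓜 w I.univ I.act a xbar).hom.hom.hom := fun _ => rfl
  -- (O-CRT) block data at `w′ := 𝔭_w` and the relative dimension `[F:ℚ]`
  have hw0 : w.asIdeal ≠ ⊥ := w.ne_bot
  have hp0 : ((I.pChar : ℕ) : 𝓞 F) ≠ 0 := Nat.cast_ne_zero.2 I.hpChar.1.ne_zero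
  obtain ⟨e', 𝔟, he, hx, hcop⟩ := exists_eq_pow_mul_coprime w.isPrime hw0 hp0 I.hpChar.2
  obtain ⟨a, ha1, ha2⟩ := exists_blockIdempotentFamily hcop e'
  have hgF : I.univ.IsOfRelDim (Module.finrank ℚ F) := I.hg ▸ I.relDim
  have hfw : Nat.card (𝓞 F ⧸ w.asIdeal) = I.pChar ^ I.fDeg := by
    rw [← Literature.NumberTheory.Automorphic.HeightOneSpectrum.card_quotient_smul (IsCMField.complexConj F) w]; exact I.hfDeg
  -- the `w`-LAYER with its rank `q²` (★ p849994; (S-H) by ★ p846766 at `w′ := 𝔭_w`)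
  obtain ⟨Gw, _, _, _, _, ιw, βw, ⟨hιwm, hιwc⟩, hkerw, -, -, hrkw⟩ :=
    Literature.AlgebraicGeometry.AbelianSchemes.AbelianSchemeOver.RingAction.exists_idealTorsionLayer_finrank_eq I.pChar I.fDeg
      ((hgF.baseChange _).baseChange _)
      ((I.act.baseChange (pullback.fst (𝓜.localise w).total.hom (specResidueField w))).baseChange
        (xbar.left : Spec (.of (geomResidueField w)) ⟶ pullback (𝓜.localise w).total.hom (specResidueField w)))
      w.asIdeal hw0 I.hpChar.2 he hx hcop a ha1 ha2
      (fun n s' => hrank_specialFibre_of_isSmoothProper (𝓜.localise w) h𝓨 hgF I.act (Fact.out : I.pChar.Prime).ne_zero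
        w.asIdeal hw0 hfw hx hcop a ha1 ha2 xbar n s')
  haveI := hιwm
  haveI := hιwc
  haveI : Mono ιw := Over.mono_of_mono_left ιw
  -- the `c•w`-LAYER := the dock `(𝔡 x̄).G₀` with `hrkG₀`
  letI := (𝔡 xbar).grp₀
  haveI := (𝔡 xbar).aff₀
  haveI := (𝔡 xbar).hι₀G.2
  haveI : Mono (𝔡 xbar).ι₀G := Over.mono_of_mono_left _
  -- `𝔭_w ⊔ 𝔭_{c•w} = ⊤`
  have hne : w.asIdeal ≠ ((IsCMField.complexConj F) • w).asIdeal := fun h => hw (HeightOneSpectrum.ext h).symm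
  have hcop' : w.asIdeal ⊔ ((IsCMField.complexConj F) • w).asIdeal = ⊤ :=
    Ideal.IsMaximal.coprime_of_ne w.isMaximal ((IsCMField.complexConj F) • w).isMaximal hne
  -- ★ p850494 on the realisation `G′`, then the two ranks
  have key := Literature.AlgebraicGeometry.GroupSchemes.IdealTorsionCoprimeSplitting.finrank_alg_eq_mul_of_idealTorsion_realisations_ringAction
    ((I.act.baseChange (pullback.fst (𝓜.localise w).total.hom (specResidueField w))).baseChange
      (xbar.left : Spec (.of (geomResidueField w)) ⟶ pullback (𝓜.localise w).total.hom (specResidueField w)))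
    hcop' ιw (fun _ t => (hkerw t).symm) (𝔡 xbar).ι₀G (fun _ t => ((𝔡 xbar).hkerG₀ t).symm) j'
    (fun _ t => (hG' t).trans (forall₂_congr fun a _ => by rw [← hact a]))
  rw [key, hrkw, (𝔡 xbar).hrkG₀]

end HrkG

end Block_G

/-! ## §R — (ρ3-K) `exists_isogW₀_of_quotLeg` PACK — LA2-p03 (g3) `IsogW0OfQuotLeg.v1` f3424bb322475ec3 (sections `Helpers` + `IsogW0OfQuotLeg`, byte-identical) -/

section Block_R

open CategoryTheory CategoryTheory.Limits NumberField IsDedekindDomain MulAction AlgebraicGeometry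
open scoped Matrix Polynomial Pointwise MonoidalCategory
open Literature.NumberTheory.GaloisRepresentations
open Literature.NumberTheory.Automorphic Literature.NumberTheory.Automorphic.UnitaryGroup
open Literature.AlgebraicGeometry.ShimuraVarieties.UnitaryCanonicalModel
open Literature.NumberTheory.Automorphic.Liu2021.AppendixC
open Literature.AlgebraicGeometry.Motives (AlgPoints IntegralModel SchemeOver thickening thickeningGalAction thickeningLift specOver)
open Literature.NumberTheory.DiophantineGeometry (geomResidueField specialFibreFunctor specResidueField)
open Literature.AlgebraicGeometry.RelativeSpec (ActionOver)
open Literature.NumberTheory.EllipticCurves (genericFibre)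
open Literature.AlgebraicGeometry.AbelianSchemes Literature.AlgebraicGeometry.AbelianSchemes.AbelianSchemeOver
open Literature.AlgebraicGeometry.GroupSchemes.AffineGroupScheme (Alg quotIncl)
open Literature.AlgebraicGeometry.GroupSchemes.IdealKernelLayerMap
open Summit.HodgeConjecture.HodgeConjecture.Cruxes.HLiu418.F0P6aModuliDatumDefs
open Summit.HodgeConjecture.HodgeConjecture.Cruxes.HLiu418.F0P6aRGDAssembly
open Summit.HodgeConjecture.HodgeConjecture.Cruxes.HLiu418.F0P6aDatumOfInputs

section Helpers

set_option maxHeartbeats 400000 in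
/-- **A COMPOSITION LAW `u ≫ v = ι(a)` BASE-CHANGES TWICE**: `(u ×_Y Y′ ×_{Y′} Y″) ≫ (v ×_Y Y′ ×_{Y′} Y″) = ((ι ×_Y Y′) ×_{Y′} Y″)(a)` (functoriality of `Over.pullback`).
[cite: Conrad2004GrossZagier, §7 (Thm. 7.5)] -/
theorem baseChangeHom₂_comp_eq_i {Y Y' Y'' : Scheme} (g : Y' ⟶ Y) (s : Y'' ⟶ Y') {A B : AbelianSchemeOver Y} {O : Type*} [CommRing O]
    (act : A.RingAction O) (u : A.X ⟶ B.X) (v : B.X ⟶ A.X) (a : O) (h : u ≫ v = act.i a) :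
    baseChangeHom (baseChangeHom u g) s ≫ baseChangeHom (baseChangeHom v g) s = ((act.baseChange g).baseChange s).i a := by
  rw [RingAction.baseChange_i, RingAction.baseChange_i, ← h]
  change (Over.pullback s).map ((Over.pullback g).map u) ≫ (Over.pullback s).map ((Over.pullback g).map v) =
    (Over.pullback s).map ((Over.pullback g).map (u ≫ v))
  rw [Functor.map_comp, Functor.map_comp]

end Helpers

section IsogW0OfQuotLeg

open scoped MonObj CategoryTheory.Obj

-- the frame of the D-line՚s `Letters` section VERBATIM
variable {F : Type} [Field F] [NumberField F] [IsCMField F] {ι₁ : F →+* ℂ}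
    {Jstar : Matrix (Fin 2) (Fin 2) F}
    {K₀ : C5.OpenCompactSubgroup ↥(finAdelic ↥(maximalRealSubfield F) F (IsCMField.complexConj F) 2 Jstar)}
    {S : RecordSystemGS F Jstar ι₁ K₀} {hU7ₛ : S.HeckeTranslateDefinedOver}
    {hJ : (Jstar.map (IsCMField.complexConj F))ᵀ = Jstar} {hJu : IsUnit Jstar}
    {Fi : Type} [Field Fi] [Algebra F Fi] {Kc : C5.SmallLevel K₀} {G : Type} [Group G]
    {𝓜 : IntegralModel (𝓞 F) F ((thickening F Fi).obj (S.M.obj Kc))}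
    {w : HeightOneSpectrum (𝓞 F)} {hw : (IsCMField.complexConj F) • w ≠ w} {h𝓨 : (𝓜.localise w).IsSmoothProper 1}
    {θ : ActionOver (𝓜.localise w).total.hom ((Fi ≃ₐ[F] Fi) × G)}
    {e : Fi →ₐ[F] AlgebraicClosure (w.adicCompletion F)}

set_option maxHeartbeats 400000 in
set_option backward.isDefEq.respectTransparency false in
/-- **THE FIBRE RETURN MAP `g_a(x̄″) : 𝒞_{x̄″} → A_{x̄″}` OF THE COVER LEG** for `a ∈ 𝔭_w`: a homomorphism with `c̄_{x̄″} ≫ g = ι_{x̄″}(a)`, `g ≫ c̄_{x̄″} = ι^𝒞_{x̄″}(a)` and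
`ι^𝒞_{x̄″}(x) ≫ g = g ≫ ι_{x̄″}(x)` (★ ED. 2 `serreTranslate_twoSided_presentation_equivariant` base-changed twice along `ι_s`, `x̄″`).
[cite: Conrad2004GrossZagier, §7 (Thm. 7.5)] [cite: MumfordAV1970, §7 Thm. 4 (p. 72)] -/
theorem exists_returnMap₀_of_mem (I : RGDInputsAt F ι₁ Jstar K₀ S hU7ₛ hJ hJu Fi Kc G 𝓜 w hw h𝓨 θ e) [IsCommMonObj I.univ.X]
    {m : ℕ} (E' : Matrix (Fin m) (Fin m) (𝓞 F)) (hE' : E' * E' = E') (P : Matrix (Fin m) (Fin 1) (𝓞 F)) (Q : Matrix (Fin 1) (Fin m) (𝓞 F))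
    (hP : E' * P = P) (hQ : Q * E' = Q) (hQP : Q * P = Matrix.scalar (Fin 1) (I.pChar : 𝓞 F))
    (hPQ : P * Q = Matrix.scalar (Fin m) (I.pChar : 𝓞 F) * E') (h𝔭 : Ideal.span (Set.range fun k => P k 0) = w.asIdeal)
    (xbar'' : AlgPoints (𝓜.localise w).reductionAt (geomResidueField w)) {a : 𝓞 F} (ha : a ∈ w.asIdeal) :
    ∃ g : (sch₀Of 𝓜 w (serreTensor I.act E' hE') xbar'').X ⟶ (sch₀Of 𝓜 w I.univ xbar'').X, IsMonHom g ∧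
      baseChangeHom (baseChangeHom (serreTranslate I.act E' hE' P) (pullback.fst (𝓜.localise w).total.hom (specResidueField w))) xbar''.left ≫ g =
        ((I.act.baseChange (pullback.fst (𝓜.localise w).total.hom (specResidueField w))).baseChange xbar''.left).i a ∧
      g ≫ baseChangeHom (baseChangeHom (serreTranslate I.act E' hE' P) (pullback.fst (𝓜.localise w).total.hom (specResidueField w))) xbar''.left =
        (((serreAction I.act E' hE').baseChange (pullback.fst (𝓜.localise w).total.hom (specResidueField w))).baseChange xbar''.left).i a ∧
      ∀ x : 𝓞 F, (((serreAction I.act E' hE').baseChange (pullback.fst (𝓜.localise w).total.hom (specResidueField w))).baseChange xbar''.left).i x ≫ g =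
        g ≫ ((I.act.baseChange (pullback.fst (𝓜.localise w).total.hom (specResidueField w))).baseChange xbar''.left).i x := by
  have hN : I.pChar ≠ 0 := I.hpChar.1.ne_zero
  -- (F13) no `obtain` over the tower: `Exists.elim`
  refine (AbelianSchemeOver.serreTranslate_twoSided_presentation_equivariant I.act E' hE' P Q hN hP hQ hQP hPQ h𝔭 ha).elim
    fun g₀ hg₀ => ?_
  haveI := hg₀.1
  haveI := isMonHom_baseChangeHom g₀ (pullback.fst (𝓜.localise w).total.hom (specResidueField w))
  refine ⟨baseChangeHom (baseChangeHom g₀ (pullback.fst (𝓜.localise w).total.hom (specResidueField w))) xbar''.left,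
    isMonHom_baseChangeHom _ xbar''.left, ?_, ?_, fun x => ?_⟩
  · exact baseChangeHom₂_comp_eq_i _ xbar''.left I.act _ g₀ a hg₀.2.1
  · exact baseChangeHom₂_comp_eq_i _ xbar''.left (serreAction I.act E' hE') g₀ _ a hg₀.2.2.1
  · exact i_baseChange_comp_baseChangeHom xbar''.left _ _ _ x
      (i_baseChange_comp_baseChangeHom (pullback.fst (𝓜.localise w).total.hom (specResidueField w)) (serreAction I.act E' hE') I.act g₀ x (hg₀.2.2.2 x))

variable (I : RGDInputsAt F ι₁ Jstar K₀ S hU7ₛ hJ hJu Fi Kc G 𝓜 w hw h𝓨 θ e) [ExpChar (geomResidueField w) I.pChar]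

set_option maxHeartbeats 400000 in
set_option backward.isDefEq.respectTransparency false in
/-- **THE COVER PIN `(𝔡 x̄″).ι₀G ≫ c̄_{x̄″} : G₀(x̄″) ↪ 𝒞_{x̄″}` IS A MONOMORPHISM** (★ ENGINE `mono_pin_comp_cover` at the return map `g_a(x̄″)`, `a ≡ 1 (𝔭_{c•w})`): the
`[Mono ι₂]` of ★ (ρ3a) `ImageIdealOfLayerMap.…_of_over` in 𝒞-currency. [cite: Tate1997FiniteFlatGroupSchemes, (1.6)–(1.7) p. 122, (3.7)] [cite: Conrad2004GrossZagier, §7 (Thm. 7.5)] -/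
theorem mono_coverPin₀ [IsCommMonObj I.univ.X]
    {m : ℕ} (E' : Matrix (Fin m) (Fin m) (𝓞 F)) (hE' : E' * E' = E') (P : Matrix (Fin m) (Fin 1) (𝓞 F)) (Q : Matrix (Fin 1) (Fin m) (𝓞 F))
    (hP : E' * P = P) (hQ : Q * E' = Q) (hQP : Q * P = Matrix.scalar (Fin 1) (I.pChar : 𝓞 F))
    (hPQ : P * Q = Matrix.scalar (Fin m) (I.pChar : 𝓞 F) * E') (h𝔭 : Ideal.span (Set.range fun k => P k 0) = w.asIdeal)
    (𝔡 : ∀ xbar, DockAt I xbar) (xbar'' : AlgPoints (𝓜.localise w).reductionAt (geomResidueField w)) :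
    Mono ((𝔡 xbar'').ι₀G ≫
        baseChangeHom (baseChangeHom (serreTranslate I.act E' hE' P) (pullback.fst (𝓜.localise w).total.hom (specResidueField w))) xbar''.left :
      (𝔡 xbar'').G₀ ⟶ (sch₀Of 𝓜 w (serreTensor I.act E' hE') xbar'').X) := by
  haveI : IsClosedImmersion (𝔡 xbar'').ι₀G.left := (𝔡 xbar'').hι₀G.2
  haveI : Mono (𝔡 xbar'').ι₀G := Over.mono_of_mono_left _
  -- (F13) no `obtain` over the tower: `Exists.elim`
  refine (Literature.NumberTheory.NumberFields.exists_mem_add_mem_eq_one_of_ne w ((IsCMField.complexConj F) • w) (Ne.symm hw)).elim fun a ha => ha.2.elim fun b hb => ?_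
  refine (exists_returnMap₀_of_mem I E' hE' P Q hP hQ hQP hPQ h𝔭 xbar'' ha.1).elim fun g hg => ?_
  exact mono_pin_comp_cover ((IsCMField.complexConj F • w).asIdeal)
    (fun x => (((I.act.baseChange (pullback.fst (𝓜.localise w).total.hom (specResidueField w))).baseChange xbar''.left).i x :
      (sch₀Of 𝓜 w I.univ xbar'').X ⟶ (sch₀Of 𝓜 w I.univ xbar'').X))
    (fun x y => RingAction.i_add _ x y) (RingAction.i_one _) (𝔡 xbar'').ι₀G (𝔡 xbar'').hkerG₀ _ g hb.2 hb.1 hg.2.1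

set_option maxHeartbeats 400000 in
/-- The cover pin `(𝔡 x̄″).ι₀G ≫ c̄_{x̄″}` is a homomorphism (the `[IsMonHom ι₂]` of ★ (ρ3a)). [cite: Tate1997FiniteFlatGroupSchemes, (1.6)–(1.7) p. 122] -/
theorem isMonHom_coverPin₀ [IsCommMonObj I.univ.X]
    {m : ℕ} (E' : Matrix (Fin m) (Fin m) (𝓞 F)) (hE' : E' * E' = E') (P : Matrix (Fin m) (Fin 1) (𝓞 F))
    (𝔡 : ∀ xbar, DockAt I xbar) (xbar'' : AlgPoints (𝓜.localise w).reductionAt (geomResidueField w)) :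
    letI := (𝔡 xbar'').grp₀
    IsMonHom ((𝔡 xbar'').ι₀G ≫
        baseChangeHom (baseChangeHom (serreTranslate I.act E' hE' P) (pullback.fst (𝓜.localise w).total.hom (specResidueField w))) xbar''.left :
      (𝔡 xbar'').G₀ ⟶ (sch₀Of 𝓜 w (serreTensor I.act E' hE') xbar'').X) := by
  letI := (𝔡 xbar'').grp₀
  -- EXPLICIT composition of the two ★ homomorphism facts, instance slots `(_)` by unification (the cover leg՚s ★ instance is keyed on the raw
  -- `(specOver …).left`-based spelling of its objects, which TC does not match against the dock∕`sch₀Of` spelling of the goal)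
  exact @CategoryTheory.instIsMonHomComp _ _ _ _ _ _ (_) (_) (_) (𝔡 xbar'').ι₀G _ (𝔡 xbar'').hι₀G.1
    (isMonHom_coverLeg (pullback.fst (𝓜.localise w).total.hom (specResidueField w)) xbar''.left I.act E' hE' P)

set_option maxHeartbeats 400000 in
set_option backward.isDefEq.respectTransparency false in
/-- **(ρ3-K) `exists_isogW₀_of_quotLeg` — THE `c•w`-LAYER MAP OF A REDUCED LEG IN 𝒞-CURRENCY, THROUGH THE COVER PIN.**  For the Serre prefix `(E′ hE′ P Q hP hQ hQP hPQ h𝔭)` of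
`𝔭_w` (scalar `p`), the docks `𝔡`, special points `x̄`, `x̄″`, and a homomorphism `ψ : A_{x̄} → 𝒞_{x̄″}` (`𝒞 = serreTensor I.act E′ hE′`) with the (ρ1𝒞) ACT row `hact`: there is
`φ : G₀(x̄) → G₀(x̄″)` with (LAYER) `φ ≫ (𝔡 x̄″).ι₀G ≫ c̄_{x̄″} = (𝔡 x̄).ι₀G ≫ ψ` (★ (ρ3a)՚s `hover`), `IsMonHom φ` (`IsogHomLaw` letter), `β₀`-EQUIVARIANCE, (KER)
`j ≫ φ = 1 ↔ j ≫ (𝔡 x̄).ι₀G ≫ ψ = 1` on all `T`-points (so the (ρ1𝒞) DOCK row IS the kernel clause of `φ`), and UNIQUENESS over (LAYER).  Unconditional: no KILL ∕ IMG row is read.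
[cite: Liu2021, Prop. D.8 (2) p. 135, p. 137] [cite: Tate1997FiniteFlatGroupSchemes, (1.6)–(1.7) p. 122, (3.7)] [cite: MumfordAV1970, §7 Thm. 4 (p. 72)] [cite: Conrad2004GrossZagier, §7 (Thm. 7.5)] -/
theorem exists_isogW₀_of_quotLeg [IsCommMonObj I.univ.X]
    {m : ℕ} (E' : Matrix (Fin m) (Fin m) (𝓞 F)) (hE' : E' * E' = E') (P : Matrix (Fin m) (Fin 1) (𝓞 F)) (Q : Matrix (Fin 1) (Fin m) (𝓞 F))
    (hP : E' * P = P) (hQ : Q * E' = Q) (hQP : Q * P = Matrix.scalar (Fin 1) (I.pChar : 𝓞 F))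
    (hPQ : P * Q = Matrix.scalar (Fin m) (I.pChar : 𝓞 F) * E') (h𝔭 : Ideal.span (Set.range fun k => P k 0) = w.asIdeal)
    (𝔡 : ∀ xbar, DockAt I xbar) (xbar xbar'' : AlgPoints (𝓜.localise w).reductionAt (geomResidueField w))
    (ψ : (sch₀Of 𝓜 w I.univ xbar).X ⟶ (sch₀Of 𝓜 w (serreTensor I.act E' hE') xbar'').X) [IsMonHom ψ]
    (hact : ∀ a : 𝓞 F, (act₀Of 𝓜 w I.univ I.act a xbar).hom.hom.hom ≫ ψ =
      ψ ≫ (act₀Of 𝓜 w (serreTensor I.act E' hE') (serreAction I.act E' hE') a xbar'').hom.hom.hom) :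
    letI := (𝔡 xbar).grp₀; letI := (𝔡 xbar'').grp₀
    ∃ φ : (𝔡 xbar).G₀ ⟶ (𝔡 xbar'').G₀,
      -- (LAYER) the square through the cover pin — ★ (ρ3a)՚s `hover` with `ι₂ := (𝔡 x̄″).ι₀G ≫ c̄_{x̄″}`, `ι₁ := (𝔡 x̄).ι₀G`
      φ ≫ (𝔡 xbar'').ι₀G ≫
          baseChangeHom (baseChangeHom (serreTranslate I.act E' hE' P) (pullback.fst (𝓜.localise w).total.hom (specResidueField w))) xbar''.left =
        (𝔡 xbar).ι₀G ≫ ψ ∧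
      -- `IsogHomLaw` letter
      IsMonHom φ ∧
      -- `𝒪_F`-equivariance on the docks
      (∀ a : 𝓞 F, (𝔡 xbar).β₀ a ≫ φ = φ ≫ (𝔡 xbar'').β₀ a) ∧
      -- (KER) the kernel of `φ` on all `T`-points is the kernel of `ι₀G ≫ ψ`
      (∀ ⦃T : SchemeOver (geomResidueField w)⦄ (j : T ⟶ (𝔡 xbar).G₀), j ≫ φ = 1 ↔ j ≫ (𝔡 xbar).ι₀G ≫ ψ = 1) ∧
      -- UNIQUENESS over (LAYER)
      ∀ φ' : (𝔡 xbar).G₀ ⟶ (𝔡 xbar'').G₀,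
        φ' ≫ (𝔡 xbar'').ι₀G ≫
            baseChangeHom (baseChangeHom (serreTranslate I.act E' hE' P) (pullback.fst (𝓜.localise w).total.hom (specResidueField w))) xbar''.left =
          (𝔡 xbar).ι₀G ≫ ψ → φ' = φ := by
  letI := (𝔡 xbar).grp₀
  letI := (𝔡 xbar'').grp₀
  -- pins: homomorphic, the target pin a monomorphism (closed immersion); the cover leg a homomorphism
  haveI := (𝔡 xbar).hι₀G.1
  haveI := (𝔡 xbar'').hι₀G.1
  haveI : IsClosedImmersion (𝔡 xbar'').ι₀G.left := (𝔡 xbar'').hι₀G.2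
  haveI : Mono (𝔡 xbar'').ι₀G := Over.mono_of_mono_left _
  haveI := isMonHom_coverLeg (pullback.fst (𝓜.localise w).total.hom (specResidueField w)) xbar''.left I.act E' hE' P
  -- the ACT row in the `.i` currency (`act₀Of` is definitionally the twice-base-changed action)
  have hψ : ∀ x : 𝓞 F,
      (((I.act.baseChange (pullback.fst (𝓜.localise w).total.hom (specResidueField w))).baseChange xbar.left).i x :
          (sch₀Of 𝓜 w I.univ xbar).X ⟶ (sch₀Of 𝓜 w I.univ xbar).X) ≫ ψ =
        ψ ≫ ((((serreAction I.act E' hE').baseChange (pullback.fst (𝓜.localise w).total.hom (specResidueField w))).baseChange xbar''.left).i x :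
          (sch₀Of 𝓜 w (serreTensor I.act E' hE') xbar'').X ⟶ (sch₀Of 𝓜 w (serreTensor I.act E' hE') xbar'').X) :=
    fun x => hact x
  -- (F13) no `obtain` over the tower: the coprime split and the fibre return map by `Exists.elim`
  refine (Literature.NumberTheory.NumberFields.exists_mem_add_mem_eq_one_of_ne w ((IsCMField.complexConj F) • w) (Ne.symm hw)).elim fun a ha => ha.2.elim fun b hb => ?_
  refine (exists_returnMap₀_of_mem I E' hE' P Q hP hQ hQP hPQ h𝔭 xbar'' ha.1).elim fun g hg => ?_
  haveI := hg.1
  exact exists_layerMap_through_cover ((IsCMField.complexConj F • w).asIdeal)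
    (fun x => (((I.act.baseChange (pullback.fst (𝓜.localise w).total.hom (specResidueField w))).baseChange xbar.left).i x :
      (sch₀Of 𝓜 w I.univ xbar).X ⟶ (sch₀Of 𝓜 w I.univ xbar).X))
    (fun x => ((((serreAction I.act E' hE').baseChange (pullback.fst (𝓜.localise w).total.hom (specResidueField w))).baseChange xbar''.left).i x :
      (sch₀Of 𝓜 w (serreTensor I.act E' hE') xbar'').X ⟶ (sch₀Of 𝓜 w (serreTensor I.act E' hE') xbar'').X))
    (fun x => (((I.act.baseChange (pullback.fst (𝓜.localise w).total.hom (specResidueField w))).baseChange xbar''.left).i x :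
      (sch₀Of 𝓜 w I.univ xbar'').X ⟶ (sch₀Of 𝓜 w I.univ xbar'').X))
    (fun x y => RingAction.i_add _ x y) (RingAction.i_one _)
    (fun x y => RingAction.i_add _ x y) (RingAction.i_one _)
    (fun x y => RingAction.i_add _ x y) (RingAction.i_one _)
    (𝔡 xbar).ι₀G (𝔡 xbar'').ι₀G (𝔡 xbar).hkerG₀ (𝔡 xbar'').hkerG₀
    (𝔡 xbar).β₀ (𝔡 xbar).hβ₀G (𝔡 xbar'').β₀ (𝔡 xbar'').hβ₀G
    ψ hψ _ g hg.2.2.2 hb.2 hb.1 hg.2.1 hg.2.2.1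

set_option maxHeartbeats 400000 in
set_option backward.isDefEq.respectTransparency false in
/-- **`isogW₀_kills_of_quotLeg` — THE `IsogKerLaw` LETTER FROM THE (ρ1𝒞) KILL ROW**: for ANY `φ` with the (LAYER) square and any `H : SubOf I 𝔡 x̄` with
`quotIncl (G₀ x̄) H.1 ≫ ι₀G ≫ ψ = 1` (the (ρ1𝒞) KILL row, `H := spGeoOf I 𝔡 y L`), `quotIncl (G₀ x̄) H.1 ≫ φ = 1` (cancel the mono hom `ι₀G(x̄″) ≫ c̄_{x̄″}`).
[cite: Liu2021, Prop. D.8 (2) p. 135, p. 137] [cite: Tate1997FiniteFlatGroupSchemes, (1.6)–(1.7) p. 122] -/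
theorem isogW₀_kills_of_quotLeg [IsCommMonObj I.univ.X]
    {m : ℕ} (E' : Matrix (Fin m) (Fin m) (𝓞 F)) (hE' : E' * E' = E') (P : Matrix (Fin m) (Fin 1) (𝓞 F)) (Q : Matrix (Fin 1) (Fin m) (𝓞 F))
    (hP : E' * P = P) (hQ : Q * E' = Q) (hQP : Q * P = Matrix.scalar (Fin 1) (I.pChar : 𝓞 F))
    (hPQ : P * Q = Matrix.scalar (Fin m) (I.pChar : 𝓞 F) * E') (h𝔭 : Ideal.span (Set.range fun k => P k 0) = w.asIdeal)
    (𝔡 : ∀ xbar, DockAt I xbar) (xbar xbar'' : AlgPoints (𝓜.localise w).reductionAt (geomResidueField w))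
    (ψ : (sch₀Of 𝓜 w I.univ xbar).X ⟶ (sch₀Of 𝓜 w (serreTensor I.act E' hE') xbar'').X)
    (φ : (𝔡 xbar).G₀ ⟶ (𝔡 xbar'').G₀)
    (hlayer : φ ≫ (𝔡 xbar'').ι₀G ≫
        baseChangeHom (baseChangeHom (serreTranslate I.act E' hE' P) (pullback.fst (𝓜.localise w).total.hom (specResidueField w))) xbar''.left =
      (𝔡 xbar).ι₀G ≫ ψ)
    (H : SubOf I 𝔡 xbar)
    (hkill : letI := (𝔡 xbar).grp₀; haveI := (𝔡 xbar).aff₀; quotIncl (𝔡 xbar).G₀ H.1 ≫ (𝔡 xbar).ι₀G ≫ ψ = 1) :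
    letI := (𝔡 xbar).grp₀; haveI := (𝔡 xbar).aff₀; letI := (𝔡 xbar'').grp₀
    quotIncl (𝔡 xbar).G₀ H.1 ≫ φ = 1 := by
  letI := (𝔡 xbar).grp₀
  haveI := (𝔡 xbar).aff₀
  letI := (𝔡 xbar'').grp₀
  haveI := (𝔡 xbar'').hι₀G.1
  haveI : IsClosedImmersion (𝔡 xbar'').ι₀G.left := (𝔡 xbar'').hι₀G.2
  haveI : Mono (𝔡 xbar'').ι₀G := Over.mono_of_mono_left _
  haveI := isMonHom_coverLeg (pullback.fst (𝓜.localise w).total.hom (specResidueField w)) xbar''.left I.act E' hE' P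
  -- (F13) `Exists.elim`, not `obtain`
  refine (Literature.NumberTheory.NumberFields.exists_mem_add_mem_eq_one_of_ne w ((IsCMField.complexConj F) • w) (Ne.symm hw)).elim fun a ha => ha.2.elim fun b hb => ?_
  refine (exists_returnMap₀_of_mem I E' hE' P Q hP hQ hQP hPQ h𝔭 xbar'' ha.1).elim fun g hg => ?_
  exact comp_eq_one_of_layer_through_cover ((IsCMField.complexConj F • w).asIdeal)
    (fun x => (((I.act.baseChange (pullback.fst (𝓜.localise w).total.hom (specResidueField w))).baseChange xbar''.left).i x :
      (sch₀Of 𝓜 w I.univ xbar'').X ⟶ (sch₀Of 𝓜 w I.univ xbar'').X))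
    (fun x y => RingAction.i_add _ x y) (RingAction.i_one _)
    (𝔡 xbar).ι₀G (𝔡 xbar'').ι₀G (𝔡 xbar'').hkerG₀ ψ _ g hb.2 hb.1 hg.2.1 hlayer _ hkill

end IsogW0OfQuotLeg

end Block_R

end Summit.HodgeConjecture.HodgeConjecture.Cruxes.HLiu418.F0P6aLineSpecialisation

end
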